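import Mathlib
import Summits.Ventures.PercRepro2.SwOutShadowMultiRootKinds
import Summits.Ventures.PercRepro2.SwOutShadowMultiRootSides

/-!
# The units of a side point meet the hull in one part (blind cell PercRepro2, night-4 g35,
2026-08-29; proofs/NIGHT4-G35.md §4)

The unit of a vertex of the red part (its cluster in the red-unit configuration) meets the
extended hull in the red part only, the unit of a vertex of the blue part in the blue part only:
the set «outside the hull, or in the part» is closed under the unit adjacency — a blue edge from
a red-part vertex cannot enter a root or the blue part (Esc.redPartR_disjoint_bluePartR,
Esc.no_edge_redPartR_bluePartR), and an edge inside the hull stays in the arm.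
-/

namespace Summit.Ventures.PercRepro2

namespace LocRows

open Hull

variable {V : Type*} {E : Type*}

open scoped Classical

variable {ends : E → Sym2 V}

section Closure

variable {R : Set V} {l : V} {ζ : Config E}

/-- The cluster of a vertex of a cluster is that cluster. -/
lemma cluster_eq_of_mem' {ρ : Config E} {x y : V} (hy : y ∈ cluster ends ρ x) :
    cluster ends ρ y = cluster ends ρ x := by
  ext z
  exact ⟨fun hz => conn_trans hy hz, fun hz => conn_trans (conn_symm hy) hz⟩

/-- A vertex of the red part is not in the blue part (the arms are monochromatic) — abbreviation
of the Esc side lemma with its hypotheses bundled. -/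
theorem unit_red_closed [Fintype E] [DecidableEq E] {U : Set V} {ξ : Config E} {h : V}
    {𝓤 𝓓 𝓓'' : Set (Set V)} {X : Set V} {𝓤' : Set (Set V)} {F : V → Prop}
    (hl : l ∉ U) (hF : ∀ x, F x → ∀ S ∈ 𝓤, x ∈ S)
    (hout : ∀ x ∈ U, x ∉ R →
      F x ∨ x ∈ X ∨ (∃ e y, ends e = s(x, y) ∧ y ∉ U) ∨ (∀ e, x ∉ ends e) ∨ ¬ hull ends ζ x ⊆ U)
    (hX : ∀ x ∈ X, x ∈ U → ∀ e, x ∈ ends e → ends e = s(x, x))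
    (hζ : ζ ∈ gOutSide ends l h 𝓤 𝓓 𝓓'' X 𝓤' U ξ) (hne : ∀ r ∈ R, hull ends ζ r ⊆ U)
    {y : V} (hy : y ∈ redPartR ends R ζ) :
    ∀ x ∈ unitOf ends R l ζ y, x ∈ extHullR ends R ζ → x ∈ redPartR ends R ζ := by
  intro x hx hxH
  have hu : unitOf ends R l ζ y = cluster ends (unitConfigB ends R l ζ) y := by
    simp only [unitOf, if_pos hy]
  rw [hu] at hx
  -- the set «outside the hull, or in the red part» is closed under the red-unit adjacency
  have key : x ∈ {v | v ∉ extHullR ends R ζ ∨ v ∈ redPartR ends R ζ} := by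
    refine mem_of_conn_of_closed (ends := ends) (ω := unitConfigB ends R l ζ) ?_ (Or.inr hy) hx
    intro a ha b hab
    obtain ⟨-, e, he, hab'⟩ := exists_edge_of_adj hab
    by_cases hbH : b ∈ extHullR ends R ζ
    · right
      by_cases hbR : b ∈ R
      · -- a root is adjacent to no vertex of a blue edge not at `l` inside … : `a` is then in the
        -- hull of `b` by the edge; the edge is blue (not inside the hull without roots), so `a` is
        -- in the blue cluster of the root `b`, hence in the blue part — unless `a` is outside the hull
        exfalso
        rcases unitConfigB_eq_true_iff.1 he with ⟨hblue, -⟩ | ⟨p, hp, q, hq, hpq⟩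
        · have hblue' : blue ζ e = true := by rw [blue_eq_true_iff]; exact hblue
          have haB : a ∈ cluster ends (blue ζ) b :=
            mem_cluster_of_edge (mem_cluster_self _ _ _) hblue' (ends_swap hab')
          rcases ha with ha | ha
          · exact ha ⟨b, hbR, Or.inr haB⟩
          · exact Esc.redPartR_disjoint_bluePartR hl hF hout hX hζ hne ha ⟨⟨b, hbR, haB⟩, ha.2⟩
        · rw [hab', Sym2.eq_iff] at hpq
          rcases hpq with ⟨-, hbq⟩ | ⟨-, hbp⟩
          · exact hq.2 (hbq ▸ hbR)
          · exact hp.2 (hbp ▸ hbR)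
      · rcases mem_redPartR_or_bluePartR hbH hbR with hb | hb
        · exact hb
        · exfalso
          rcases unitConfigB_eq_true_iff.1 he with ⟨hblue, -⟩ | ⟨p, hp, q, hq, hpq⟩
          · -- a blue edge from `a` into the blue part puts `a` in the blue part
            have hblue' : blue ζ e = true := by rw [blue_eq_true_iff]; exact hblue
            obtain ⟨⟨r, hr, hbr⟩, -⟩ := hb
            have haB : a ∈ cluster ends (blue ζ) r := mem_cluster_of_edge hbr hblue' (ends_swap hab')
            rcases ha with ha | ha
            · exact ha ⟨r, hr, Or.inr haB⟩
            · exact Esc.redPartR_disjoint_bluePartR hl hF hout hX hζ hne ha ⟨⟨r, hr, haB⟩, ha.2⟩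
          · -- an edge inside the hull without roots: `a` is in the hull, hence in the red part,
            -- joined to the blue part by an edge
            have haH : a ∈ extHullR ends R ζ \ R := by
              rw [hab', Sym2.eq_iff] at hpq
              rcases hpq with ⟨hap, -⟩ | ⟨haq, -⟩
              · rw [hap]; exact hp
              · rw [haq]; exact hq
            rcases ha with ha | ha
            · exact ha haH.1
            · exact Esc.no_edge_redPartR_bluePartR hl hF hout hX hζ hne hab' ha hb
    · exact Or.inl hbH
  rcases key with h' | h'
  · exact absurd hxH h'
  · exact h'

/-- A vertex of the blue part: its unit meets the hull in the blue part only. -/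
theorem unit_blue_closed [Fintype E] [DecidableEq E] {U : Set V} {ξ : Config E} {h : V}
    {𝓤 𝓓 𝓓'' : Set (Set V)} {X : Set V} {𝓤' : Set (Set V)} {F : V → Prop}
    (hl : l ∉ U) (hF : ∀ x, F x → ∀ S ∈ 𝓤, x ∈ S)
    (hout : ∀ x ∈ U, x ∉ R →
      F x ∨ x ∈ X ∨ (∃ e y, ends e = s(x, y) ∧ y ∉ U) ∨ (∀ e, x ∉ ends e) ∨ ¬ hull ends ζ x ⊆ U)
    (hX : ∀ x ∈ X, x ∈ U → ∀ e, x ∈ ends e → ends e = s(x, x))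
    (hζ : ζ ∈ gOutSide ends l h 𝓤 𝓓 𝓓'' X 𝓤' U ξ) (hne : ∀ r ∈ R, hull ends ζ r ⊆ U)
    {y : V} (hy : y ∈ bluePartR ends R ζ) :
    ∀ x ∈ unitOf ends R l ζ y, x ∈ extHullR ends R ζ → x ∈ bluePartR ends R ζ := by
  intro x hx hxH
  have hyR : y ∉ redPartR ends R ζ := fun h' =>
    Esc.redPartR_disjoint_bluePartR hl hF hout hX hζ hne h' hy
  have hu : unitOf ends R l ζ y = cluster ends (unitConfigR ends R l ζ) y := by
    simp only [unitOf, if_neg hyR]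
  rw [hu] at hx
  have key : x ∈ {v | v ∉ extHullR ends R ζ ∨ v ∈ bluePartR ends R ζ} := by
    refine mem_of_conn_of_closed (ends := ends) (ω := unitConfigR ends R l ζ) ?_ (Or.inr hy) hx
    intro a ha b hab
    obtain ⟨-, e, he, hab'⟩ := exists_edge_of_adj hab
    by_cases hbH : b ∈ extHullR ends R ζ
    · right
      by_cases hbR : b ∈ R
      · exfalso
        rcases unitConfigR_eq_true_iff.1 he with ⟨hred, -⟩ | ⟨p, hp, q, hq, hpq⟩
        · have haA : a ∈ cluster ends ζ b :=
            mem_cluster_of_edge (mem_cluster_self _ _ _) hred (ends_swap hab')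
          rcases ha with ha | ha
          · exact ha ⟨b, hbR, Or.inl haA⟩
          · exact Esc.redPartR_disjoint_bluePartR hl hF hout hX hζ hne ⟨⟨b, hbR, haA⟩, ha.2⟩ ha
        · rw [hab', Sym2.eq_iff] at hpq
          rcases hpq with ⟨-, hbq⟩ | ⟨-, hbp⟩
          · exact hq.2 (hbq ▸ hbR)
          · exact hp.2 (hbp ▸ hbR)
      · rcases mem_redPartR_or_bluePartR hbH hbR with hb | hb
        · exfalso
          rcases unitConfigR_eq_true_iff.1 he with ⟨hred, -⟩ | ⟨p, hp, q, hq, hpq⟩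
          · obtain ⟨⟨r, hr, hbr⟩, -⟩ := hb
            have haA : a ∈ cluster ends ζ r := mem_cluster_of_edge hbr hred (ends_swap hab')
            rcases ha with ha | ha
            · exact ha ⟨r, hr, Or.inl haA⟩
            · exact Esc.redPartR_disjoint_bluePartR hl hF hout hX hζ hne ⟨⟨r, hr, haA⟩, ha.2⟩ ha
          · have haH : a ∈ extHullR ends R ζ \ R := by
              rw [hab', Sym2.eq_iff] at hpq
              rcases hpq with ⟨hap, -⟩ | ⟨haq, -⟩
              · rw [hap]; exact hp
              · rw [haq]; exact hq
            rcases ha with ha | ha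
            · exact ha haH.1
            · exact Esc.no_edge_redPartR_bluePartR hl hF hout hX hζ hne (ends_swap hab') hb ha
        · exact hb
    · exact Or.inl hbH
  rcases key with h' | h'
  · exact absurd hxH h'
  · exact h'

end Closure

end LocRows

end Summit.Ventures.PercRepro2
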